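import Mathlib.Analysis.SpecialFunctions.SmoothTransition
import Mathlib.Analysis.SpecialFunctions.Integrals.Basic
import Mathlib.MeasureTheory.Integral.IntervalIntegral.FundThmCalculus
import Mathlib.Analysis.Calculus.ContDiff.Deriv
import Mathlib.Analysis.Calculus.Deriv.Slope
import HarnessLib

/-!
# A smooth concave ramp (witness helper 3 of line `green-blowup-conformal-entropy`)

Route `SmoothPoincare4/EntropyRung`, crux `SubcylindricalExistence` (stmt-SmoothPoincare4-10871),
registered stub `helper_concaveRamp`: for `0 < s₁ < s₂` there is a smooth `θ : ℝ → ℝ` with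
`θ(s) = s` for `s ≤ s₁`, `θ` constant on `[s₂, ∞)`, `0 ≤ θ' ≤ 1` everywhere, `θ' < 1` on
`(s₁, ∞)`, `θ'' ≤ 0`, and `θ(s₂) > 0`.  It is used to taper the conformal factor
`W = θ(2/(1 + ⟪x, p⟫))` on the round `S⁴`.

Construction (pure one-variable calculus, Mathlib only; no new definitions):
* `concaveRamp_exists_profile`: the profile `φ(s) = Real.smoothTransition ((s − s₁)/(s₂ − s₁))`
  is smooth, monotone, `= 0` on `(−∞, s₁]`, `= 1` on `[s₂, ∞)`, with values in `[0, 1]` and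
  `> 0` on `(s₁, ∞)`;
* `concaveRamp_exists_of_profile`: for any such profile the ramp `θ(s) = s₁ + ∫_{s₁}^{s} (1 − φ)`
  works: by FTC-1 (`concaveRamp_hasDerivAt_primitive`) `θ' = 1 − φ`, so `θ` is smooth
  (`contDiff_infty_iff_deriv`), `θ'' = (1 − φ)' ≤ 0` because `1 − φ` is antitone
  (`Antitone.deriv_nonpos`), `θ(s) = s` below `s₁` (integrand `≡ 1` there), `θ` is constant
  beyond `s₂` (integrand `≡ 0` there) and `θ(s₂) ≥ s₁ > 0`.

Everything here is folklore; no named facts are used.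
-/

-- the registered namespace `Summit.SmoothPoincare4.SmoothPoincare4.Theorems` repeats a component
set_option linter.dupNamespace false

noncomputable section

open scoped ContDiff Topology
open Set Filter MeasureTheory intervalIntegral

namespace Summit.SmoothPoincare4.SmoothPoincare4.Theorems

/-- **The ramp profile.** For `s₁ < s₂`, `φ(s) = smoothTransition ((s − s₁)/(s₂ − s₁))` is a smooth
monotone step: `0` on `(−∞, s₁]`, `1` on `[s₂, ∞)`, valued in `[0, 1]`, positive on `(s₁, ∞)`.
[folklore] -/
theorem concaveRamp_exists_profile {s₁ s₂ : ℝ} (h : s₁ < s₂) :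
    ∃ φ : ℝ → ℝ, ContDiff ℝ ∞ φ ∧ Monotone φ ∧ (∀ s, s ≤ s₁ → φ s = 0) ∧ (∀ s, s₂ ≤ s → φ s = 1) ∧
      (∀ s, 0 ≤ φ s) ∧ (∀ s, φ s ≤ 1) ∧ (∀ s, s₁ < s → 0 < φ s) := by
  refine ⟨fun s ↦ Real.smoothTransition ((s - s₁) / (s₂ - s₁)),
    Real.smoothTransition.contDiff.comp ((contDiff_id.sub contDiff_const).div_const _),
    fun a b hab ↦ ?_, fun s hs ↦ ?_, fun s hs ↦ ?_, fun s ↦ Real.smoothTransition.nonneg _,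
    fun s ↦ Real.smoothTransition.le_one _, fun s hs ↦ ?_⟩
  · exact Real.smoothTransition.monotone (div_le_div_of_nonneg_right (by linarith) (by linarith))
  · exact Real.smoothTransition.zero_of_nonpos
      (div_nonpos_of_nonpos_of_nonneg (by linarith) (by linarith))
  · exact Real.smoothTransition.one_of_one_le ((one_le_div (by linarith)).2 (by linarith))
  · exact Real.smoothTransition.pos_of_pos (div_pos (by linarith) (by linarith))

/-- **FTC-1 for a shifted primitive**: for continuous `g`, `u ↦ c + ∫_a^u g` has derivative `g(s)`
at every `s`. [folklore] -/
theorem concaveRamp_hasDerivAt_primitive {g : ℝ → ℝ} (hg : Continuous g) (a c s : ℝ) :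
    HasDerivAt (fun u ↦ c + ∫ t in a..u, g t) (g s) s :=
  ((hg.integral_hasStrictDerivAt a s).hasDerivAt).const_add c

/-- **The ramp from a profile.** If `0 < s₁ < s₂` and `φ` is smooth, monotone, `0` on `(−∞, s₁]`,
`1` on `[s₂, ∞)`, valued in `[0, 1]` and positive on `(s₁, ∞)`, then
`θ(s) = s₁ + ∫_{s₁}^{s} (1 − φ)` is smooth, `θ(s) = s` for `s ≤ s₁`, `θ` is constant on `[s₂, ∞)`,
`0 ≤ θ' = 1 − φ ≤ 1`, `θ' < 1` on `(s₁, ∞)`, `θ'' ≤ 0` and `θ(s₂) > 0`. [folklore] -/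
theorem concaveRamp_exists_of_profile {s₁ s₂ : ℝ} (h₁ : 0 < s₁) (h₁₂ : s₁ < s₂) {φ : ℝ → ℝ}
    (hφs : ContDiff ℝ ∞ φ) (hφm : Monotone φ) (hφ0 : ∀ s, s ≤ s₁ → φ s = 0)
    (hφ1 : ∀ s, s₂ ≤ s → φ s = 1) (hφnn : ∀ s, 0 ≤ φ s) (hφle : ∀ s, φ s ≤ 1)
    (hφpos : ∀ s, s₁ < s → 0 < φ s) :
    ∃ θ : ℝ → ℝ, ContDiff ℝ ∞ θ ∧ (∀ s, s ≤ s₁ → θ s = s) ∧ (∀ s, s₂ ≤ s → θ s = θ s₂) ∧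
      (∀ s, 0 ≤ deriv θ s) ∧ (∀ s, deriv θ s ≤ 1) ∧ (∀ s, s₁ < s → deriv θ s < 1) ∧
      (∀ s, deriv (deriv θ) s ≤ 0) ∧ 0 < θ s₂ := by
  -- the integrand `1 - φ`
  have hgs : ContDiff ℝ ∞ fun t ↦ 1 - φ t := contDiff_const.sub hφs
  have hgc : Continuous fun t ↦ 1 - φ t := hgs.continuous
  -- FTC-1: `θ' = 1 - φ`
  have hD : ∀ s, HasDerivAt (fun u ↦ s₁ + ∫ t in s₁..u, (1 - φ t)) (1 - φ s) s :=
    fun s ↦ concaveRamp_hasDerivAt_primitive hgc s₁ s₁ s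
  have hd : deriv (fun u ↦ s₁ + ∫ t in s₁..u, (1 - φ t)) = fun t ↦ 1 - φ t :=
    funext fun s ↦ (hD s).deriv
  refine ⟨fun u ↦ s₁ + ∫ t in s₁..u, (1 - φ t), ?_, fun s hs ↦ ?_, fun s hs ↦ ?_, fun s ↦ ?_,
    fun s ↦ ?_, fun s hs ↦ ?_, fun s ↦ ?_, ?_⟩
  · -- smoothness: `θ` is differentiable with smooth derivative `1 - φ`
    refine contDiff_infty_iff_deriv.2 ⟨fun s ↦ (hD s).differentiableAt, ?_⟩
    rw [hd]
    exact hgs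
  · -- `θ s = s` for `s ≤ s₁`: the integrand is `1` on `[s, s₁]`
    have hI : ∫ t in s₁..s, (1 - φ t) = ∫ _ in s₁..s, (1 : ℝ) := by
      refine intervalIntegral.integral_congr fun t ht ↦ ?_
      rw [uIcc_of_ge hs] at ht
      simp only [hφ0 t ht.2, sub_zero]
    show s₁ + ∫ t in s₁..s, (1 - φ t) = s
    rw [hI, integral_one]
    ring
  · -- `θ` is constant on `[s₂, ∞)`: the integrand is `0` there
    have hI : ∫ t in s₂..s, (1 - φ t) = ∫ _ in s₂..s, (0 : ℝ) := by
      refine intervalIntegral.integral_congr fun t ht ↦ ?_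
      rw [uIcc_of_le hs] at ht
      simp only [hφ1 t ht.1, sub_self]
    show s₁ + ∫ t in s₁..s, (1 - φ t) = s₁ + ∫ t in s₁..s₂, (1 - φ t)
    rw [← intervalIntegral.integral_add_adjacent_intervals (hgc.intervalIntegrable s₁ s₂)
      (hgc.intervalIntegrable s₂ s), hI, intervalIntegral.integral_zero, add_zero]
  · -- `0 ≤ θ'`
    rw [hd]
    exact sub_nonneg.2 (hφle s)
  · -- `θ' ≤ 1`
    rw [hd]
    exact sub_le_self _ (hφnn s)
  · -- `θ' < 1` beyond `s₁`
    rw [hd]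
    exact sub_lt_self _ (hφpos s hs)
  · -- `θ'' ≤ 0`: `1 - φ` is antitone
    rw [hd]
    exact Antitone.deriv_nonpos fun a b hab ↦ sub_le_sub_left (hφm hab) 1
  · -- `θ s₂ ≥ s₁ > 0`
    have hI : 0 ≤ ∫ t in s₁..s₂, (1 - φ t) :=
      intervalIntegral.integral_nonneg h₁₂.le fun t _ ↦ sub_nonneg.2 (hφle t)
    show 0 < s₁ + ∫ t in s₁..s₂, (1 - φ t)
    linarith

/-- **Witness helper 3 — a smooth concave ramp**: for `0 < s₁ < s₂` a smooth `θ` with `θ(s) = s`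
for `s ≤ s₁`, `θ` constant on `[s₂, ∞)`, `0 ≤ θ' ≤ 1`, `θ' < 1` beyond `s₁`, `θ'' ≤ 0`,
`θ(s₂) > 0` (`θ' = 1 − smoothTransition((s − s₁)/(s₂ − s₁))`, `θ = s₁ + ∫_{s₁} θ'`). [folklore] -/
theorem helper_concaveRamp :
    ∀ (s₁ s₂ : ℝ), 0 < s₁ → s₁ < s₂ → ∃ θ : ℝ → ℝ, ContDiff ℝ ∞ θ ∧ (∀ s, s ≤ s₁ → θ s = s) ∧ (∀ s,
      s₂ ≤ s → θ s = θ s₂) ∧ (∀ s, 0 ≤ deriv θ s) ∧ (∀ s, deriv θ s ≤ 1) ∧ (∀ s, s₁ < s → deriv θ s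
      < 1) ∧ (∀ s, deriv (deriv θ) s ≤ 0) ∧ 0 < θ s₂ := by
  intro s₁ s₂ h₁ h₁₂
  obtain ⟨φ, hφs, hφm, hφ0, hφ1, hφnn, hφle, hφpos⟩ := concaveRamp_exists_profile h₁₂
  exact concaveRamp_exists_of_profile h₁ h₁₂ hφs hφm hφ0 hφ1 hφnn hφle hφpos

end Summit.SmoothPoincare4.SmoothPoincare4.Theorems

end
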